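import Summits.QuantumFields.YangMills.Theorems.UnitScaleTiltProp7CombLadderCount
import HarnessLib

/-!
# Route `UnitScaleTilt`, crux K1 «MinimiserStabilityRegPr» (stmt-QuantumFields-19200), route-R E′, S3 K-form engine, ROW (H) — hLap INHABITANT, FILE D (ℤ^d comb combinatorics):
# REGROUPING THE RUNG DIFFERENCES BY COMB SITE — `Σ_μ Σ_(k<|B_μ|) g_μ(rung k of the tail of μ) = Σ_κ Σ_(j<|v κ|) Σ_(μ listed before κ) g_μ(j-th point of the κ-run)`:
# the rungs of ALL directions `μ` lie on the ONE comb `Γ_(0,v)`, and a point of the `κ`-run is a rung of exactly the directions listed before `κ`; so the first-order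
# Laplacian term of ✓ `Prop7LapCombFirstOrder` (summed over `μ`) is a sum over comb SITES of the sum over those `μ` — at the last run ALL other directions (the current
# letter), at an earlier run the directions before it — and the norm is taken AFTER that inner sum (the LOCATE's «form the current before the norm»)

Cell `ym3-torus`, width seat `ym3-torus-px4` (gen 4); ★ym-ust-19200-p1 g16 NAMER WORD 14 «px4 g4: hLap INHABITANT GO» (2026-08-29 00:17Z), road (iii).  THEOREMS ONLY (0 `def`,
0 `sorry`); `--supports stmt-QuantumFields-19200`, count-neutral.  YM₃ on T³ is a ladder rung (R3), not the Clay problem; nothing here claims hLap, hRes, (H), S3, E′, a stub,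
the crux, d = 4 or the mass gap.

SETTING.  The comb order is `(finRange d).reverse`; for every direction `μ` a split `(finRange d).reverse = s μ ++ μ :: t μ` is displayed (as in ✓ `Prop7CombLadder`); the comb
to `v` is `Γ(v) = (s μ).flatMap run ++ seg μ (v μ) ++ (t μ).flatMap run`, `run κ = seg κ (v κ)`; the tail rungs of direction `μ` sit at `q_μ + disp(B_μ↾k)`,
`q_μ = disp((s μ).flatMap run ++ seg μ (v μ))`, `B_μ = (t μ).flatMap run` (the letters of ✓ `Prop7LapCombFirstOrder.norm_lapDefect_comb_add_comm_sum_le`, there with `w = v − e_μ`).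

WHAT IS PROVED (ns `…Theorems.Prop7LapCombRegroup`).
* §1 lists: `split_unique` (a nodup list splits at an element in one way), `mem_split_after_iff_mem_split_before` (`κ ∈ t μ ↔ μ ∈ s κ`), `split_before_of_mem_after`
  (`t μ = u ++ κ :: w ⇒ s κ = s μ ++ μ :: u`), `sum_range_getD_eq_sum_toFinset`.
* §2 rung sums: ★ `sum_rungs_flatMap` (the rungs of a concatenation of runs, run by run — ✓ `sum_range_rungs_append` iterated), `base_run_eq` (the base of the `κ`-run inside the tail of `μ`
  is the comb prefix of `κ`: `q_μ + disp(((t μ)↾i).flatMap run) = disp((s κ).flatMap run)`).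
* §3 ★★★ `sum_dirs_tailRungs_eq_sum_sites` (the title identity, any `AddCommMonoid`), ★★ `norm_comm_sum_dirs_tailRungs_le` (normed ring: `‖[Σ_μ Σ_k g_μ(…), m]‖ ≤ Σ_κ Σ_j N_m(Σ_(μ∈s κ) g_μ(p_(κ,j), l_(κ,j)))`
  — the norm AFTER the sum over the directions at each site).
HONEST SCOPE.  Finite-sum bookkeeping; no holonomy, no estimate; the identification of the inner sum at last-run sites with the current letter of ✓ `Prop7CurrentConjugationDefect`
and the counts over `v` in a box are the next files.

References: T. Bałaban, CMP 98 (1985) 17–51 [Balaban1985Averaging] ((8)–(9) pp.18–19, p.24); CMP 102 (1985) 255–275 [Balaban1985UV3] ((27) p.263); CMP 99 (1985) 75–102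
[Balaban1985RegularSpaces] ((1.1)–(1.2) p.76, (1.9) p.77).
-/

set_option autoImplicit false

noncomputable section

open scoped BigOperators

namespace Summit.QuantumFields.YangMills.Theorems.Prop7LapCombRegroup

open Literature.MathematicalPhysics.QuantumFieldTheory.Balaban1983to89
open B7Prop1Explicit (Site Letter e disp seg disp_append length_seg)
open Summit.QuantumFields.YangMills.Theorems.Prop7CombLadderCount (sum_range_rungs_append split_nodup)

/-! ## §1 Lists: splits of a nodup list -/

section Lists

variable {α : Type*}

/-- a nodup list splits at a given element in exactly one way. [folklore] -/
theorem split_unique {κ : α} : ∀ (s s' : List α) {t t' : List α}, (s ++ κ :: t).Nodup → s ++ κ :: t = s' ++ κ :: t' → s = s' ∧ t = t'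
  | [], [], t, t', _, h => ⟨rfl, by simpa using h⟩
  | [], a :: s', t, t', hnd, h => by
    exfalso
    simp only [List.nil_append, List.cons_append, List.cons.injEq] at h hnd
    obtain ⟨rfl, rfl⟩ := h
    rw [List.nodup_cons] at hnd
    exact hnd.1 (List.mem_append_right _ List.mem_cons_self)
  | a :: s, [], t, t', hnd, h => by
    exfalso
    simp only [List.nil_append, List.cons_append, List.cons.injEq] at h
    obtain ⟨rfl, h2⟩ := h
    rw [List.cons_append, List.nodup_cons] at hnd
    exact hnd.1 (List.mem_append_right _ List.mem_cons_self)
  | a :: s, a' :: s', t, t', hnd, h => by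
    simp only [List.cons_append, List.cons.injEq] at h
    obtain ⟨rfl, h2⟩ := h
    rw [List.cons_append, List.nodup_cons] at hnd
    obtain ⟨h3, h4⟩ := split_unique s s' hnd.2 h2
    exact ⟨by rw [h3], h4⟩

variable {d : ℕ} (s t : Fin d → List (Fin d)) (hsplit : ∀ μ, (List.finRange d).reverse = s μ ++ μ :: t μ)

include hsplit in
/-- if `κ` is listed after `μ` (`t μ = u ++ κ :: w`), the directions listed before `κ` are those before `μ`, then `μ`, then `u`: `s κ = s μ ++ μ :: u` (and `t κ = w`). [folklore] -/
theorem split_before_of_mem_after {μ κ : Fin d} {u w : List (Fin d)} (hu : t μ = u ++ κ :: w) : s κ = s μ ++ μ :: u ∧ t κ = w := by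
  have hnd : (s κ ++ κ :: t κ).Nodup := (hsplit κ) ▸ List.nodup_reverse.mpr (List.nodup_finRange d)
  have h1 : s κ ++ κ :: t κ = (s μ ++ μ :: u) ++ κ :: w := by
    rw [← hsplit κ, hsplit μ, hu]; simp
  exact split_unique (s κ) (s μ ++ μ :: u) hnd h1

include hsplit in
/-- `κ` is listed after `μ` iff `μ` is listed before `κ`: `κ ∈ t μ ↔ μ ∈ s κ`. [folklore] -/
theorem mem_split_after_iff_mem_split_before (μ κ : Fin d) : κ ∈ t μ ↔ μ ∈ s κ := by
  constructor
  · intro hκ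
    obtain ⟨u, w, hu⟩ := List.append_of_mem hκ
    rw [(split_before_of_mem_after s t hsplit hu).1]
    exact List.mem_append_right _ List.mem_cons_self
  · intro hμ
    obtain ⟨u, w, hu⟩ := List.append_of_mem hμ
    have hnd : (s μ ++ μ :: t μ).Nodup := (hsplit μ) ▸ List.nodup_reverse.mpr (List.nodup_finRange d)
    have h1 : s μ ++ μ :: t μ = u ++ μ :: (w ++ κ :: t κ) := by
      rw [← hsplit μ, hsplit κ, hu]; simp
    rw [(split_unique (s μ) u hnd h1).2]
    exact List.mem_append_right _ List.mem_cons_self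

omit hsplit in
/-- a `range`-indexed sum over the entries of a nodup list is the sum over its finset. [folklore] -/
theorem sum_range_getD_eq_sum_toFinset {M : Type*} [AddCommMonoid M] (f : Fin d → M) (dflt : Fin d) :
    ∀ (l : List (Fin d)), l.Nodup → ∑ i ∈ Finset.range l.length, f (l.getD i dflt) = ∑ κ ∈ l.toFinset, f κ
  | [], _ => by simp
  | κ :: l, hnd => by
    rw [List.nodup_cons] at hnd
    rw [List.length_cons, Finset.sum_range_succ', List.toFinset_cons, Finset.sum_insert (fun h => hnd.1 (List.mem_toFinset.mp h)), add_comm]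
    simp only [List.getD_cons_succ, List.getD_cons_zero]
    rw [sum_range_getD_eq_sum_toFinset f dflt l hnd.2]

end Lists

/-! ## §2 Rung sums over a concatenation of runs -/

section Rungs

variable {d : ℕ} {M : Type*} [AddCommMonoid M]

/-- ★ **THE RUNGS OF A CONCATENATION OF RUNS, RUN BY RUN**: for directions `l` and the word `l.flatMap (κ ↦ seg κ (v κ))` based at `p`,
`Σ_(k<|word|) g(p + disp(word↾k), word[k]) = Σ_(i<|l|) Σ_(j<|v l[i]|) g(p + disp((l↾i).flatMap …) + disp((seg l[i] (v l[i]))↾j), (seg l[i] (v l[i]))[j])`.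
[cite: Balaban1985Averaging, (8)-(9) pp.18-19, p.24] -/
theorem sum_rungs_flatMap (g : Site d → Letter d → M) (dflt : Letter d) (κ₀ : Fin d) (v : Site d) :
    ∀ (l : List (Fin d)) (p : Site d),
      ∑ k ∈ Finset.range (l.flatMap (fun κ => seg κ (v κ))).length,
          g (p + disp ((l.flatMap (fun κ => seg κ (v κ))).take k)) ((l.flatMap (fun κ => seg κ (v κ))).getD k dflt)
        = ∑ i ∈ Finset.range l.length, ∑ j ∈ Finset.range (v (l.getD i κ₀)).natAbs,
            g (p + disp ((l.take i).flatMap (fun κ => seg κ (v κ))) + disp ((seg (l.getD i κ₀) (v (l.getD i κ₀))).take j))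
              ((seg (l.getD i κ₀) (v (l.getD i κ₀))).getD j dflt)
  | [], p => by simp
  | κ :: l, p => by
    rw [List.flatMap_cons, sum_range_rungs_append, List.length_cons, Finset.sum_range_succ', sum_rungs_flatMap g dflt κ₀ v l (p + disp (seg κ (v κ)))]
    simp only [List.getD_cons_succ, List.getD_cons_zero, List.take_succ_cons, List.take_zero, List.flatMap_cons, List.flatMap_nil, disp_append,
      B7Prop1Explicit.disp_nil, add_zero, length_seg, add_assoc]
    rw [add_comm]

variable (s t : Fin d → List (Fin d)) (hsplit : ∀ μ, (List.finRange d).reverse = s μ ++ μ :: t μ)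

include hsplit in
/-- **THE BASE OF A RUN INSIDE A TAIL IS THE COMB PREFIX OF THAT RUN**: for `i < |t μ|` and `κ = (t μ)[i]`,
`disp((s μ).flatMap run ++ seg μ (v μ)) + disp(((t μ)↾i).flatMap run) = disp((s κ).flatMap run)`, `run ν = seg ν (v ν)`. [cite: Balaban1985Averaging, (8)-(9) pp.18-19] -/
theorem base_run_eq (v : Site d) (μ : Fin d) (i : ℕ) (hi : i < (t μ).length) :
    disp ((s μ).flatMap (fun κ => seg κ (v κ)) ++ seg μ (v μ)) + disp (((t μ).take i).flatMap (fun κ => seg κ (v κ)))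
      = disp ((s ((t μ).getD i μ)).flatMap (fun κ => seg κ (v κ))) := by
  have hu : t μ = (t μ).take i ++ (t μ).getD i μ :: (t μ).drop (i + 1) := by
    rw [List.getD_eq_getElem _ _ hi, ← List.drop_eq_getElem_cons hi, List.take_append_drop]
  rw [(split_before_of_mem_after s t hsplit hu).1]
  simp only [List.flatMap_append, List.flatMap_cons, disp_append, B7Prop1Explicit.disp_seg, add_assoc]

end Rungs

/-! ## §3 The regrouping by comb site -/

section Regroup

variable {d : ℕ} (s t : Fin d → List (Fin d)) (hsplit : ∀ μ, (List.finRange d).reverse = s μ ++ μ :: t μ)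

include hsplit in
/-- ★★★ **REGROUPING THE TAIL RUNGS OF ALL DIRECTIONS BY COMB SITE**: with `run κ = seg κ (v κ)`, `q_μ = disp((s μ).flatMap run ++ seg μ (v μ))`, `B_μ = (t μ).flatMap run`,
`Σ_μ Σ_(k<|B_μ|) g μ (q_μ + disp(B_μ↾k)) (B_μ[k]) = Σ_κ Σ_(j<|v κ|) Σ_(μ ∈ s κ) g μ (disp((s κ).flatMap run) + disp((run κ)↾j)) ((run κ)[j])` — every point of the `κ`-run of the comb
`Γ(0,v)` is a tail rung of exactly the directions listed BEFORE `κ`. [cite: Balaban1985Averaging, (8)-(9) pp.18-19, p.24; Balaban1985UV3, (27) p.263] -/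
theorem sum_dirs_tailRungs_eq_sum_sites {M : Type*} [AddCommMonoid M] (g : Fin d → Site d → Letter d → M) (dflt : Letter d) (v : Site d) :
    ∑ μ : Fin d, ∑ k ∈ Finset.range ((t μ).flatMap (fun κ => seg κ (v κ))).length,
        g μ (disp ((s μ).flatMap (fun κ => seg κ (v κ)) ++ seg μ (v μ)) + disp (((t μ).flatMap (fun κ => seg κ (v κ))).take k))
          (((t μ).flatMap (fun κ => seg κ (v κ))).getD k dflt)
      = ∑ κ : Fin d, ∑ j ∈ Finset.range (v κ).natAbs, ∑ μ ∈ (s κ).toFinset,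
          g μ (disp ((s κ).flatMap (fun ν => seg ν (v ν))) + disp ((seg κ (v κ)).take j)) ((seg κ (v κ)).getD j dflt) := by
  classical
  -- the inner function of a site, summed over its run: `F μ κ`
  set F : Fin d → Fin d → M := fun μ κ => ∑ j ∈ Finset.range (v κ).natAbs,
      g μ (disp ((s κ).flatMap (fun ν => seg ν (v ν))) + disp ((seg κ (v κ)).take j)) ((seg κ (v κ)).getD j dflt) with hF
  -- (1) per direction: the tail sum run by run, bases = comb prefixes
  have step1 : ∀ μ : Fin d, ∑ k ∈ Finset.range ((t μ).flatMap (fun κ => seg κ (v κ))).length,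
        g μ (disp ((s μ).flatMap (fun κ => seg κ (v κ)) ++ seg μ (v μ)) + disp (((t μ).flatMap (fun κ => seg κ (v κ))).take k))
          (((t μ).flatMap (fun κ => seg κ (v κ))).getD k dflt)
      = ∑ i ∈ Finset.range (t μ).length, F μ ((t μ).getD i μ) := fun μ => by
    rw [sum_rungs_flatMap (g μ) dflt μ v (t μ)]
    refine Finset.sum_congr rfl fun i hi => ?_
    rw [base_run_eq s t hsplit v μ i (Finset.mem_range.mp hi)]
  -- (2) the entries of `t μ` as a finset, then Fubini through `κ ∈ t μ ↔ μ ∈ s κ`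
  have hndt : ∀ μ, (t μ).Nodup := fun μ => (split_nodup μ (hsplit μ)).2.1
  have hnds : ∀ κ, (s κ).Nodup := fun κ => (split_nodup κ (hsplit κ)).1
  have step2 : ∀ μ : Fin d, ∑ i ∈ Finset.range (t μ).length, F μ ((t μ).getD i μ) = ∑ κ : Fin d, if κ ∈ t μ then F μ κ else 0 := fun μ => by
    rw [sum_range_getD_eq_sum_toFinset (F μ) μ (t μ) (hndt μ), ← Finset.sum_filter]
    refine Finset.sum_congr ?_ fun _ _ => rfl
    ext κ; simp
  simp_rw [step1, step2]
  rw [Finset.sum_comm]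
  refine Finset.sum_congr rfl fun κ _ => ?_
  have step3 : ∑ μ : Fin d, (if κ ∈ t μ then F μ κ else 0) = ∑ μ ∈ (s κ).toFinset, F μ κ := by
    rw [← Finset.sum_filter]
    refine Finset.sum_congr ?_ fun _ _ => rfl
    ext μ
    simp only [Finset.mem_filter, Finset.mem_univ, true_and, List.mem_toFinset]
    exact mem_split_after_iff_mem_split_before s t hsplit μ κ
  rw [step3, hF]
  exact Finset.sum_comm

end Regroup

/-! ## §4 The norm after the inner sum -/

section Normed

variable {d : ℕ} {𝔸 : Type*} [NormedRing 𝔸] (s t : Fin d → List (Fin d)) (hsplit : ∀ μ, (List.finRange d).reverse = s μ ++ μ :: t μ)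

include hsplit in
/-- ★★ **THE COMMUTATOR WITH THE REGROUPED FIRST-ORDER TERM, NORM AFTER THE INNER SUM**: for `g : Fin d → Site d → Letter d → 𝔸`,
`‖[Σ_μ Σ_(k<|B_μ|) g μ (q_μ + disp(B_μ↾k)) (B_μ[k]), m]‖ ≤ Σ_κ Σ_(j<|v κ|) N_m(Σ_(μ∈s κ) g μ (p_(κ,j)) (l_(κ,j)))` — the triangle inequality is taken over comb SITES, the sum over
the directions `μ` listed before the site's run stays INSIDE the commutator (at a last-run site: all other directions = the current letter).
[cite: Balaban1985RegularSpaces, (1.1)-(1.2) p.76, (1.9) p.77; Balaban1985Averaging, p.24] -/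
theorem norm_comm_sum_dirs_tailRungs_le (g : Fin d → Site d → Letter d → 𝔸) (dflt : Letter d) (v : Site d) (m : 𝔸) :
    ‖(∑ μ : Fin d, ∑ k ∈ Finset.range ((t μ).flatMap (fun κ => seg κ (v κ))).length,
          g μ (disp ((s μ).flatMap (fun κ => seg κ (v κ)) ++ seg μ (v μ)) + disp (((t μ).flatMap (fun κ => seg κ (v κ))).take k))
            (((t μ).flatMap (fun κ => seg κ (v κ))).getD k dflt)) * m
        - m * ∑ μ : Fin d, ∑ k ∈ Finset.range ((t μ).flatMap (fun κ => seg κ (v κ))).length,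
          g μ (disp ((s μ).flatMap (fun κ => seg κ (v κ)) ++ seg μ (v μ)) + disp (((t μ).flatMap (fun κ => seg κ (v κ))).take k))
            (((t μ).flatMap (fun κ => seg κ (v κ))).getD k dflt)‖
      ≤ ∑ κ : Fin d, ∑ j ∈ Finset.range (v κ).natAbs,
          ‖(∑ μ ∈ (s κ).toFinset, g μ (disp ((s κ).flatMap (fun ν => seg ν (v ν))) + disp ((seg κ (v κ)).take j)) ((seg κ (v κ)).getD j dflt)) * m
            - m * ∑ μ ∈ (s κ).toFinset, g μ (disp ((s κ).flatMap (fun ν => seg ν (v ν))) + disp ((seg κ (v κ)).take j)) ((seg κ (v κ)).getD j dflt)‖ := by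
  rw [sum_dirs_tailRungs_eq_sum_sites s t hsplit g dflt v, Finset.sum_mul, Finset.mul_sum, ← Finset.sum_sub_distrib]
  refine (norm_sum_le _ _).trans (Finset.sum_le_sum fun κ _ => ?_)
  rw [Finset.sum_mul, Finset.mul_sum, ← Finset.sum_sub_distrib]
  exact norm_sum_le _ _

end Normed

end Summit.QuantumFields.YangMills.Theorems.Prop7LapCombRegroup

end
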